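import Summits.CriticalPhenomena.PercolationContinuityZ3.Theorems.PercNearOneGluingNoHeavyLowerTailSahiCTCRtThreeSepDefs
import Summits.CriticalPhenomena.PercolationContinuityZ3.Theorems.PercNearOneGluingNoHeavyLowerTailSahiCTCRtThreeBigHarrisForm
import HarnessLib

/-!
# `NoHeavyLowerTail` (crux stmt-CriticalPhenomena-4575), P3 lane: the squarefree row of `R_3` as a BILINEAR FORM in the two membership
# indicators (memo g49 §3; first of four proof files leading to separable certificates; definitions in `…RtThreeSepDefs`)

Support file (seat `prim-l12-p3`, gen 49; `--supports stmt-CriticalPhenomena-4575`).  Memo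
`run/shared/lean/prim/prim-l12/FROM-prim-l12-p3-g49-SEPARABLE-CERTIFICATES.md` §3.

* **`coeff_ind_Rt_three_eq_bilinear`** : for every pair of families and every finset `V`,
  `[s^V] R_3(𝒳,𝒵) = Σ_{S,S' ⊆ V} [S ∈ 𝒳][S' ∈ 𝒵] · M_V(S,S')` with
  `M_V(S,S') = [S = S', 3 ≤ #S]·#{U ⊆ V∖S : #U ≤ 2} − [S ∩ S' = ∅, #(V∖(S∪S')) ≤ 2] + [S ∩ S' = ∅, #S < 3, #S' < 3]` (`Mrow`).
The next files (`…RtThreeAtoms`, `…RtThreeCorners`, `…RtThreeSepCert`) bound this form below by weighted sums of single-step atoms.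
Nothing is asserted about the crux.
-/

noncomputable section

open scoped Classical

namespace Summit.CriticalPhenomena.PercolationContinuityZ3.Theorems.SahiCTCForms

open Finset MvPolynomial SahiCTCGenFun

variable {α : Type*} [DecidableEq α] [Fintype α]

/-! ### The bilinear form of the squarefree row -/

section Bilinear
variable (F G : Finset (Finset α)) (V : Finset α)

/-- `pairsAt 2^α B W = #{Q ∈ B : Q ⊆ W}` — with an arbitrary first factor the pair is determined by its second member. [this work] -/
theorem pairsAt_univ_powerset (B : Finset (Finset α)) (W : Finset α) :
    pairsAt (univ.powerset : Finset (Finset α)) B W = #(B.filter fun Q => Q ⊆ W) := by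
  unfold pairsAt
  refine card_bij (fun p _ => p.2) (fun p hp => ?_) (fun p hp q hq h => ?_) (fun Q hQ => ?_)
  · obtain ⟨hpAB, hd, hu⟩ := mem_filter.1 hp
    exact mem_filter.2 ⟨(mem_product.1 hpAB).2, hu ▸ subset_union_right⟩
  · obtain ⟨-, hd, hu⟩ := mem_filter.1 hp
    obtain ⟨-, hd', hu'⟩ := mem_filter.1 hq
    have h1 : p.1 = W \ p.2 := by rw [← hu, union_sdiff_right, hd.sdiff_eq_left]
    have h2 : q.1 = W \ q.2 := by rw [← hu', union_sdiff_right, hd'.sdiff_eq_left]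
    exact Prod.ext (by rw [h1, h2, h]) h
  · obtain ⟨hQB, hQW⟩ := mem_filter.1 hQ
    exact ⟨(W \ Q, Q), mem_filter.2 ⟨mem_product.2 ⟨mem_powerset.2 (subset_univ _), hQB⟩, sdiff_disjoint, sdiff_union_of_subset hQW⟩, rfl⟩

omit [Fintype α] in
/-- The number of ordered pairs of `A × B` partitioning `W`, as a double sum of indicators over the subsets of any `V ⊇ W`. [this work] -/
theorem pairsAt_eq_sum_sum (A B : Finset (Finset α)) {V W : Finset α} (hW : W ⊆ V) :
    (pairsAt A B W : ℤ) = ∑ S ∈ V.powerset, ∑ S' ∈ V.powerset, ι A S * ι B S' * (if Disjoint S S' ∧ S ∪ S' = W then 1 else 0) := by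
  unfold pairsAt ι
  set filt := (A ×ˢ B).filter fun PQ => Disjoint PQ.1 PQ.2 ∧ PQ.1 ∪ PQ.2 = W with hfilt
  have hterm : ∀ S S' : Finset α,
      (if S ∈ A then (1:ℤ) else 0) * (if S' ∈ B then 1 else 0) * (if Disjoint S S' ∧ S ∪ S' = W then 1 else 0)
        = if (S, S') ∈ filt then 1 else 0 := by
    intro S S'
    by_cases h1 : S ∈ A <;> by_cases h2 : S' ∈ B <;> by_cases h3 : Disjoint S S' ∧ S ∪ S' = W <;>
      simp [hfilt, h1, h2, h3, mem_filter, mem_product]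
  simp_rw [hterm]
  rw [← sum_product' (f := fun S S' => if (S, S') ∈ filt then (1:ℤ) else 0), sum_boole]
  congr 1
  refine congrArg _ ?_
  ext p
  simp only [hfilt, mem_filter, mem_product, mem_powerset]
  constructor
  · intro h
    obtain ⟨hab, hd, hu⟩ := h
    exact ⟨⟨(subset_union_left.trans hu.le).trans hW, (subset_union_right.trans hu.le).trans hW⟩, hab, hd, hu⟩
  · exact fun h => h.2

omit [Fintype α] in
/-- For `S, S' ⊆ V`: exactly one `U ⊆ V` has `S ∪ S' = V ∖ U`, namely `V ∖ (S ∪ S')`; summing an indicator over the `U` of size `< 3`. [this work] -/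
theorem sum_ite_union_eq_sdiff {V S S' : Finset α} (hS : S ⊆ V) (hS' : S' ⊆ V) (p : Finset α → Prop) [DecidablePred p] :
    ∑ U ∈ V.powerset.filter p, (if S ∪ S' = V \ U then (1:ℤ) else 0) = if p (V \ (S ∪ S')) then 1 else 0 := by
  have hsub : S ∪ S' ⊆ V := union_subset hS hS'
  have key : ∀ U ∈ V.powerset.filter p, (S ∪ S' = V \ U ↔ U = V \ (S ∪ S')) := by
    intro U hU
    have hUV : U ⊆ V := mem_powerset.1 (mem_filter.1 hU).1
    constructor
    · intro h; rw [h, Finset.sdiff_sdiff_eq_self hUV]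
    · intro h; rw [h, Finset.sdiff_sdiff_eq_self hsub]
  rw [sum_congr rfl fun U hU => if_congr (key U hU) rfl rfl, sum_ite_eq' (V.powerset.filter p) (V \ (S ∪ S')) (fun _ => (1:ℤ))]
  simp only [mem_filter, mem_powerset, sdiff_subset, true_and]

omit [Fintype α] in
/-- `Σ_{U ⊆ V, p U} pairsAt A B (V∖U)` as a double sum of indicators. [this work] -/
theorem sum_pairsAt_eq_sum_sum (A B : Finset (Finset α)) (V : Finset α) (p : Finset α → Prop) [DecidablePred p] :
    ∑ U ∈ V.powerset.filter p, (pairsAt A B (V \ U) : ℤ) =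
      ∑ S ∈ V.powerset, ∑ S' ∈ V.powerset, ι A S * ι B S' * (if Disjoint S S' ∧ p (V \ (S ∪ S')) then 1 else 0) := by
  rw [sum_congr rfl fun U _ => pairsAt_eq_sum_sum A B (V := V) (W := V \ U) sdiff_subset]
  rw [sum_comm]
  refine sum_congr rfl fun S hS => ?_
  rw [sum_comm]
  refine sum_congr rfl fun S' hS' => ?_
  rw [← mul_sum]
  congr 1
  have hSV := mem_powerset.1 hS; have hS'V := mem_powerset.1 hS'
  by_cases hd : Disjoint S S'
  · simp only [hd, true_and]
    exact sum_ite_union_eq_sdiff hSV hS'V p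
  · simp only [hd, false_and, if_false, sum_const_zero]

omit [Fintype α] in
/-- `Σ_{U ⊆ V, #U < 3} #{Y ∈ B : Y ⊆ V∖U}` as a diagonal double sum. [this work] -/
theorem sum_card_filter_subset_eq (F G : Finset (Finset α)) (V : Finset α) :
    ∑ U ∈ V.powerset.filter (fun U => #U < 3), (#((atLeast 3 (F ∩ G)).filter fun Y => Y ⊆ V \ U) : ℤ) =
      ∑ S ∈ V.powerset, ∑ S' ∈ V.powerset, ι F S * ι G S' *
        (if S = S' ∧ 3 ≤ #S then (#((V \ S).powerset.filter fun U => #U ≤ 2) : ℤ) else 0) := by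
  -- collapse the diagonal
  have hdiag : ∀ S ∈ V.powerset, ∑ S' ∈ V.powerset, ι F S * ι G S' *
      (if S = S' ∧ 3 ≤ #S then (#((V \ S).powerset.filter fun U => #U ≤ 2) : ℤ) else 0)
      = ι F S * ι G S * (if 3 ≤ #S then (#((V \ S).powerset.filter fun U => #U ≤ 2) : ℤ) else 0) := by
    intro S hS
    rw [← sum_filter_add_sum_filter_not V.powerset (fun S' => S' = S)]
    have h1 : V.powerset.filter (fun S' => S' = S) = {S} := by
      ext S'; simp only [mem_filter, mem_powerset, mem_singleton]
      exact ⟨fun h => h.2, fun h => ⟨h ▸ mem_powerset.1 hS, h⟩⟩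
    rw [h1, sum_singleton]
    have h2 : ∑ S' ∈ V.powerset.filter (fun S' => ¬ S' = S), ι F S * ι G S' *
        (if S = S' ∧ 3 ≤ #S then (#((V \ S).powerset.filter fun U => #U ≤ 2) : ℤ) else 0) = 0 :=
      sum_eq_zero fun S' hS' => by
        have hne : ¬ S' = S := (mem_filter.1 hS').2
        rw [if_neg (fun h => hne h.1.symm), mul_zero]
    rw [h2, add_zero]
    by_cases h3 : 3 ≤ #S <;> simp [h3]
  rw [sum_congr rfl hdiag]
  -- the left side: count pairs (U, Y)
  have hL : ∀ U ∈ V.powerset.filter (fun U => #U < 3),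
      (#((atLeast 3 (F ∩ G)).filter fun Y => Y ⊆ V \ U) : ℤ) =
        ∑ S ∈ V.powerset, ι F S * ι G S * (if 3 ≤ #S then (if S ⊆ V \ U then 1 else 0) else 0) := by
    intro U hU
    have : ((atLeast 3 (F ∩ G)).filter fun Y => Y ⊆ V \ U) =
        V.powerset.filter fun S => S ∈ F ∧ S ∈ G ∧ 3 ≤ #S ∧ S ⊆ V \ U := by
      ext S; simp only [atLeast, mem_filter, mem_inter, mem_powerset]
      constructor
      · rintro ⟨⟨⟨hF, hG⟩, h3⟩, hsub⟩; exact ⟨hsub.trans sdiff_subset, hF, hG, h3, hsub⟩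
      · rintro ⟨-, hF, hG, h3, hsub⟩; exact ⟨⟨⟨hF, hG⟩, h3⟩, hsub⟩
    rw [this, natCast_card_filter]
    refine sum_congr rfl fun S _ => ?_
    unfold ι
    by_cases hF : S ∈ F <;> by_cases hG : S ∈ G <;> by_cases h3 : 3 ≤ #S <;> by_cases hs : S ⊆ V \ U <;> simp [hF, hG, h3, hs]
  rw [sum_congr rfl hL, sum_comm]
  refine sum_congr rfl fun S hS => ?_
  rw [← mul_sum]
  congr 1
  by_cases h3 : 3 ≤ #S
  · simp only [h3, if_true]
    have hSV := mem_powerset.1 hS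
    -- Σ_{U ⊆ V, #U<3} [S ⊆ V \ U] = #{U ⊆ V \ S : #U ≤ 2}
    rw [sum_boole]
    congr 1
    refine congrArg _ ?_
    ext U
    simp only [mem_filter, mem_powerset]
    constructor
    · rintro ⟨⟨hUV, hU3⟩, hSU⟩
      exact ⟨fun x hx => mem_sdiff.2 ⟨hUV hx, fun hxS => (mem_sdiff.1 (hSU hxS)).2 hx⟩, by omega⟩
    · rintro ⟨hU, hU2⟩
      refine ⟨⟨fun x hx => (mem_sdiff.1 (hU hx)).1, by omega⟩, fun x hx => mem_sdiff.2 ⟨hSV hx, fun hxU => (mem_sdiff.1 (hU hxU)).2 hx⟩⟩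
  · simp only [h3, if_false, sum_const_zero]

/-- **THE SQUAREFREE ROW AS A BILINEAR FORM**: `[s^V] R_3(𝒳,𝒵) = Σ_{S,S' ⊆ V} [S ∈ 𝒳][S' ∈ 𝒵]·M_V(S,S')` for every pair of families
(`Mrow`). [this work] -/
theorem coeff_ind_Rt_three_eq_bilinear (F G : Finset (Finset α)) (V : Finset α) :
    (Rt 3 F G).coeff (ind V) = ∑ S ∈ V.powerset, ∑ S' ∈ V.powerset, ι F S * ι G S' * Mrow V S S' := by
  have hR : Rt 3 F G = gf (bySize (· < 3)) * (gf (univ.powerset : Finset (Finset α)) * gf (atLeast 3 (F ∩ G)))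
      - gf (bySize (· < 3)) * (gf F * gf G) + PiP * (gf (below 3 F) * gf (below 3 G)) := by
    unfold Rt PiP; ring
  rw [hR, coeff_add, coeff_sub, coeff_ind_bySize_mul_gf_mul_gf, coeff_ind_bySize_mul_gf_mul_gf, coeff_ind_PiP_mul_gf_mul_gf]
  simp_rw [pairsAt_univ_powerset]
  rw [sum_card_filter_subset_eq, sum_pairsAt_eq_sum_sum F G V (fun U => #U < 3)]
  have h3 : ∑ S₀ ∈ V.powerset, (pairsAt (below 3 F) (below 3 G) (V \ S₀) : ℤ) =
      ∑ S ∈ V.powerset, ∑ S' ∈ V.powerset, ι F S * ι G S' * (if Disjoint S S' ∧ #S < 3 ∧ #S' < 3 then 1 else 0) := by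
    have := sum_pairsAt_eq_sum_sum (below 3 F) (below 3 G) V (fun _ => True)
    rw [filter_true_of_mem (fun _ _ => trivial)] at this
    rw [this]
    refine sum_congr rfl fun S _ => sum_congr rfl fun S' _ => ?_
    unfold ι below
    by_cases hF : S ∈ F <;> by_cases hG : S' ∈ G <;> by_cases hd : Disjoint S S' <;> by_cases hs : #S < 3 <;> by_cases hs' : #S' < 3 <;>
      simp [hF, hG, hd, hs, hs', mem_filter]
  rw [h3, ← sum_sub_distrib, ← sum_add_distrib]
  refine sum_congr rfl fun S hS => ?_
  rw [← sum_sub_distrib, ← sum_add_distrib]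
  refine sum_congr rfl fun S' hS' => ?_
  unfold Mrow
  have hcard : ∀ W : Finset α, (#W < 3 ↔ #W ≤ 2) := fun W => by omega
  simp only [hcard]
  ring

end Bilinear

end Summit.CriticalPhenomena.PercolationContinuityZ3.Theorems.SahiCTCForms
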